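import Summits.Ventures.Crystal3D.Theorems.StickyWulffConstantCoaxialWallLawWordCore
import Summits.Ventures.Crystal3D.Theorems.StickyWulffConstantCoaxialWallLawReachableCount
import HarnessLib

/-!
# Exact end accounting for the word automaton, II: sources ≤ REACHABLE ENDS + rim (the abstract exact count)

HONEST FRAMING. Part of the venture `Summits/Ventures/Crystal3D` (cell `crystal3d-full`), helper for the crux
`CoaxialWallLaw` (stmt-Ventures-19481) of `route-Ventures-StickyWulffConstant`, REGISTERED line `WallLedgerF`
(planner cf-p1 gen 16), open stub `stub_coaxialTwoSlabAdhesion` (general fillings).  Rung credit only; F-C1 not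
moved.  Fourth variant of 19481-p2's abstract NET count `word_sources_le` (`…WordCore`; after `…WordCoreNoBand`,
`…WordCoreNoTop`, `…WordCoreStateInv`), for EXACT END ACCOUNTING (memo F-FRONTIER-g5 §4(b), evidence on the crux
item).  The earlier variants charge every END to SOME unsaturated ball within contact distance one
(`word_end_pays`, multiplicity `13·M`); this one hands the ends over RAW and REACHABLE:

  `#sources ≤ #{v ∈ W : window, v NOT moving, P v, v = f u for a MOVING u ∈ W} + M·#rim_top + M·#rim_bottom`,

so that the next bricks can charge a reachable end `(b, κ)` to its OWN ball (`…EndStar`: a move target carries the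
closed star of its arrival slot; `…EndGap`: its predecessor `b − d κ` is the saturated ball it was moved from) and
bound the END MULTIPLICITY of `b` instead of the class multiplicity `M` (which survives only in the rim terms).
GENERALITY: a STATE INVARIANT `P` as in `…WordCoreStateInv` (at the first image of every source, preserved by the
full/glide and cross move forms) AND the top grain as a FRAME `G₂` as in `…WordCoreNoTop`; the top-exit exclusion
is their common weakening `hPexcl`: «no certified state carrying `P` sits on a ball of the top sample `P₂` with a
full `G₂`-shell» (twins, in-plane root: `P := True` + «no class has a `60°` triangle in `G₂`'s slots»,
`shell_slot_of_full`; translations: the position invariants of `…Triadic` / `…WordPlane` give `v.1 ∉ P₂`).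
NO kissing facts are used (they entered the earlier variants only through `word_end_pays`).  Proof = the proof
of `word_sources_le_of_stateInvariant` with `card_sources_le_ends_add_exits_of_invariant` (`…ReachableCount`)
applied to `P v ∧ ∃ u ∈ W, u moving ∧ f u = v`, the end term left uncharged, and the top exit closed by `hPexcl`
on the full `G₂`-shell of a sealed `P₂`-ball (as in `…WordCoreNoTop`).

WHAT THIS IS NOT: not the stub; end charging, multiplicity bounds and the assembly are the next bricks; F-C1 not
moved.
-/
noncomputable section

namespace Summit.Ventures.Crystal3D.Theorems

open Summit.Ventures.Crystal3D Finset
open Literature.MathematicalPhysics.StatisticalMechanics (fccStacking)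
open scoped InnerProductSpace

variable {X : Finset (EuclideanSpace ℝ (Fin 3))}

section Core

variable {K : Type*} {F : K → (EuclideanSpace ℝ (Fin 3) ≃ₗᵢ[ℝ] EuclideanSpace ℝ (Fin 3))}
  {d : K → EuclideanSpace ℝ (Fin 3)} {next : K → EuclideanSpace ℝ (Fin 3) → K}
  {W : Finset (EuclideanSpace ℝ (Fin 3) × K)}
  {f : EuclideanSpace ℝ (Fin 3) × K → EuclideanSpace ℝ (Fin 3) × K}
  {root : K} {G₂ : EuclideanSpace ℝ (Fin 3) ≃ₗᵢ[ℝ] EuclideanSpace ℝ (Fin 3)}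
  {P₁ P' P₂ : Finset (EuclideanSpace ℝ (Fin 3))} {t₁ t₂ : EuclideanSpace ℝ (Fin 3)}
  {R₀ h ρ : ℝ} {M : ℕ} {P : EuclideanSpace ℝ (Fin 3) × K → Prop}

open scoped Classical in
/-- **The exact count: sources ≤ reachable ends + rim.**  See the module docstring. -/
theorem word_sources_le_exact
    (hX : ∀ p ∈ X, ∀ q ∈ X, p ≠ q → 1 ≤ dist p q)
    (hd : ∀ κ, ∃ u ∈ fccSlots, d κ = F κ u)
    (hdn : ∀ κ, ∃ m : EuclideanSpace ℝ (Fin 3), ‖m‖ = 1 ∧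
      (∀ w ∈ fccSlots, ⟪F κ w, m⟫_ℝ = 0 ∨ ⟪F κ w, m⟫_ℝ = Real.sqrt (2 / 3) ∨ ⟪F κ w, m⟫_ℝ = -Real.sqrt (2 / 3)) ∧
      ⟪d κ, m⟫_ℝ = Real.sqrt (2 / 3))
    (hmirror : ∀ κ (m : EuclideanSpace ℝ (Fin 3)), ‖m‖ = 1 →
      (∀ w ∈ fccSlots, ⟪F κ w, m⟫_ℝ = 0 ∨ ⟪F κ w, m⟫_ℝ = Real.sqrt (2 / 3) ∨ ⟪F κ w, m⟫_ℝ = -Real.sqrt (2 / 3)) →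
      ⟪d κ, m⟫_ℝ = Real.sqrt (2 / 3) → ∀ x, F (next κ m) x = F κ x - (2 * ⟪F κ x, m⟫_ℝ) • m)
    (hinv : ∀ κ (m : EuclideanSpace ℝ (Fin 3)), ‖m‖ = 1 →
      (∀ w ∈ fccSlots, ⟪F κ w, m⟫_ℝ = 0 ∨ ⟪F κ w, m⟫_ℝ = Real.sqrt (2 / 3) ∨ ⟪F κ w, m⟫_ℝ = -Real.sqrt (2 / 3)) →
      ⟪d κ, m⟫_ℝ = Real.sqrt (2 / 3) → next (next κ m) m = κ)
    (hdnext : ∀ κ (m : EuclideanSpace ℝ (Fin 3)), ‖m‖ = 1 →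
      (∀ w ∈ fccSlots, ⟪F κ w, m⟫_ℝ = 0 ∨ ⟪F κ w, m⟫_ℝ = Real.sqrt (2 / 3) ∨ ⟪F κ w, m⟫_ℝ = -Real.sqrt (2 / 3)) →
      ⟪d κ, m⟫_ℝ = Real.sqrt (2 / 3) → ⟪d (next κ m), m⟫_ℝ = Real.sqrt (2 / 3))
    (hW : ∀ v, v ∈ W ↔ (v.1 ∈ X ∧
      (∃ a ∈ fccSlots, ∃ a' ∈ fccSlots, ∃ a'' ∈ fccSlots,
        ⟪a, a'⟫_ℝ = 1 / 2 ∧ ⟪a, a''⟫_ℝ = 1 / 2 ∧ ⟪a', a''⟫_ℝ = 1 / 2 ∧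
        v.1 + F v.2 a ∈ X ∧ v.1 + F v.2 a' ∈ X ∧ v.1 + F v.2 a'' ∈ X) ∧
      v.1 - d v.2 ∈ X))
    (hmult : ∀ b ∈ X, (W.filter fun v => v.1 = b).card ≤ M)
    (hf_full : ∀ v ∈ W, (∀ w ∈ fccSlots, v.1 + F v.2 w ∈ X) → f v = (v.1 + d v.2, v.2))
    (hf_cross : ∀ v ∈ W, ∀ m : EuclideanSpace ℝ (Fin 3), ‖m‖ = 1 →
      (∀ w ∈ fccSlots, ⟪F v.2 w, m⟫_ℝ = 0 ∨ ⟪F v.2 w, m⟫_ℝ = Real.sqrt (2 / 3) ∨ ⟪F v.2 w, m⟫_ℝ = -Real.sqrt (2 / 3)) →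
      (∀ w ∈ fccSlots, ⟪F v.2 w, m⟫_ℝ ≤ 0 → v.1 + F v.2 w ∈ X) →
      (∀ w ∈ fccSlots, ⟪F v.2 w, m⟫_ℝ < 0 → v.1 + (F v.2 w - (2 * ⟪F v.2 w, m⟫_ℝ) • m) ∈ X) →
      (∀ w ∈ fccSlots, 0 < ⟪F v.2 w, m⟫_ℝ → v.1 + F v.2 w ∉ X) →
      ⟪d v.2, m⟫_ℝ = Real.sqrt (2 / 3) → f v = (v.1 + d (next v.2 m), next v.2 m))
    (hf_glide : ∀ v ∈ W, ∀ m : EuclideanSpace ℝ (Fin 3), ‖m‖ = 1 →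
      (∀ w ∈ fccSlots, ⟪F v.2 w, m⟫_ℝ = 0 ∨ ⟪F v.2 w, m⟫_ℝ = Real.sqrt (2 / 3) ∨ ⟪F v.2 w, m⟫_ℝ = -Real.sqrt (2 / 3)) →
      (∀ w ∈ fccSlots, ⟪F v.2 w, m⟫_ℝ ≤ 0 → v.1 + F v.2 w ∈ X) →
      (∀ w ∈ fccSlots, ⟪F v.2 w, m⟫_ℝ < 0 → v.1 + (F v.2 w - (2 * ⟪F v.2 w, m⟫_ℝ) • m) ∈ X) →
      (∀ w ∈ fccSlots, 0 < ⟪F v.2 w, m⟫_ℝ → v.1 + F v.2 w ∉ X) →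
      ⟪d v.2, m⟫_ℝ = 0 → f v = (v.1 + d v.2, v.2))
    (hroot : ∀ κ, (∃ a ∈ fccSlots, ∃ a' ∈ fccSlots, ∃ a'' ∈ fccSlots,
        ⟪a, a'⟫_ℝ = 1 / 2 ∧ ⟪a, a''⟫_ℝ = 1 / 2 ∧ ⟪a', a''⟫_ℝ = 1 / 2 ∧
        (∃ w ∈ fccSlots, F root w = F κ a) ∧ (∃ w ∈ fccSlots, F root w = F κ a') ∧
        (∃ w ∈ fccSlots, F root w = F κ a'')) → κ = root)
    (hup : 0 < d root 2)
    (hPsrc : ∀ p ∈ P', (∀ w ∈ fccSlots, p + F root w ∈ X) → P (p + d root, root))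
    (hPfull : ∀ v ∈ W, P v → P (v.1 + d v.2, v.2))
    (hPcross : ∀ v ∈ W, ∀ m : EuclideanSpace ℝ (Fin 3), ‖m‖ = 1 →
      (∀ w ∈ fccSlots, ⟪F v.2 w, m⟫_ℝ = 0 ∨ ⟪F v.2 w, m⟫_ℝ = Real.sqrt (2 / 3) ∨ ⟪F v.2 w, m⟫_ℝ = -Real.sqrt (2 / 3)) →
      ⟪d v.2, m⟫_ℝ = Real.sqrt (2 / 3) → P v → P (v.1 + d (next v.2 m), next v.2 m))
    (hPexcl : ∀ v ∈ W, P v → v.1 ∈ P₂ → (∀ w ∈ fccSlots, v.1 + G₂ w ∈ X) → False)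
    (hR₀ : 3 ≤ R₀) (hρ : R₀ ≤ ρ)
    (hcell : ∀ p ∈ X, -(2 * R₀) ≤ p 2 ∧ p 2 ≤ h + 2 * R₀ ∧ p 0 ^ 2 + p 1 ^ 2 ≤ ρ ^ 2)
    (hP₁X : P₁ ⊆ X) (hP₂X : P₂ ⊆ X)
    (hP₁ : ∀ p, p ∈ P₁ ↔ (p ∈ (fun q => F root q + t₁) '' fccStacking 1 (Real.sqrt (2 / 3)) ∧
      -(2 * R₀) ≤ p 2 ∧ p 2 ≤ -R₀ ∧ p 0 ^ 2 + p 1 ^ 2 ≤ ρ ^ 2))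
    (hP' : ∀ p, p ∈ P' ↔ (p ∈ (fun q => F root q + t₁) '' fccStacking 1 (Real.sqrt (2 / 3)) ∧
      -(2 * R₀) + 1 ≤ p 2 ∧ p 2 ≤ -R₀ - 1 ∧ p 0 ^ 2 + p 1 ^ 2 ≤ (ρ - 1) ^ 2))
    (hP'full : ∀ p ∈ P', ∀ w ∈ fccSlots, p + F root w ∈ X)
    (hP₂ : ∀ p, p ∈ P₂ ↔ (p ∈ (fun q => G₂ q + t₂) '' fccStacking 1 (Real.sqrt (2 / 3)) ∧
      h + R₀ ≤ p 2 ∧ p 2 ≤ h + 2 * R₀ ∧ p 0 ^ 2 + p 1 ^ 2 ≤ ρ ^ 2)) :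
    (P'.filter fun p => (∀ w ∈ fccSlots, p + F root w ∈ X) ∧
        -R₀ - 1 < (p + d root) 2 ∧ (p + d root) 2 < h + R₀ + 1).card ≤
      (W.filter fun v => -R₀ - 1 ≤ v.1 2 ∧ v.1 2 < h + R₀ + 1 ∧
          ¬ ((∀ w ∈ fccSlots, v.1 + F v.2 w ∈ X) ∨
            ∃ m : EuclideanSpace ℝ (Fin 3), ‖m‖ = 1 ∧
              (∀ w ∈ fccSlots, ⟪F v.2 w, m⟫_ℝ = 0 ∨ ⟪F v.2 w, m⟫_ℝ = Real.sqrt (2 / 3) ∨ ⟪F v.2 w, m⟫_ℝ = -Real.sqrt (2 / 3)) ∧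
              (∀ w ∈ fccSlots, ⟪F v.2 w, m⟫_ℝ ≤ 0 → v.1 + F v.2 w ∈ X) ∧
              (∀ w ∈ fccSlots, ⟪F v.2 w, m⟫_ℝ < 0 → v.1 + (F v.2 w - (2 * ⟪F v.2 w, m⟫_ℝ) • m) ∈ X) ∧
              (∀ w ∈ fccSlots, 0 < ⟪F v.2 w, m⟫_ℝ → v.1 + F v.2 w ∉ X) ∧
              (⟪d v.2, m⟫_ℝ = Real.sqrt (2 / 3) ∨ ⟪d v.2, m⟫_ℝ = 0)) ∧
          P v ∧
          ∃ u ∈ W, ((∀ w ∈ fccSlots, u.1 + F u.2 w ∈ X) ∨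
            ∃ m : EuclideanSpace ℝ (Fin 3), ‖m‖ = 1 ∧
              (∀ w ∈ fccSlots, ⟪F u.2 w, m⟫_ℝ = 0 ∨ ⟪F u.2 w, m⟫_ℝ = Real.sqrt (2 / 3) ∨ ⟪F u.2 w, m⟫_ℝ = -Real.sqrt (2 / 3)) ∧
              (∀ w ∈ fccSlots, ⟪F u.2 w, m⟫_ℝ ≤ 0 → u.1 + F u.2 w ∈ X) ∧
              (∀ w ∈ fccSlots, ⟪F u.2 w, m⟫_ℝ < 0 → u.1 + (F u.2 w - (2 * ⟪F u.2 w, m⟫_ℝ) • m) ∈ X) ∧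
              (∀ w ∈ fccSlots, 0 < ⟪F u.2 w, m⟫_ℝ → u.1 + F u.2 w ∉ X) ∧
              (⟪d u.2, m⟫_ℝ = Real.sqrt (2 / 3) ∨ ⟪d u.2, m⟫_ℝ = 0)) ∧ f u = v).card +
      M * (X.filter fun s => h + R₀ + 1 ≤ s 2 ∧ s 2 ≤ h + R₀ + 1 + 1 ∧ (ρ - 2) ^ 2 < s 0 ^ 2 + s 1 ^ 2).card +
      M * (X.filter fun s => -R₀ - 1 - 1 ≤ s 2 ∧ s 2 < -R₀ - 1 ∧ (ρ - 1) ^ 2 < s 0 ^ 2 + s 1 ^ 2).card := by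
  have hr : 0 < Real.sqrt (2 / 3) := Real.sqrt_pos.2 (by norm_num)
  have hρ1 : (1 : ℝ) ≤ ρ := by linarith
  set zlo : ℝ := -R₀ - 1 with hzlo
  set zcut : ℝ := h + R₀ + 1 with hzcut
  set mov : EuclideanSpace ℝ (Fin 3) × K → Prop := fun v => (∀ w ∈ fccSlots, v.1 + F v.2 w ∈ X) ∨
      ∃ m : EuclideanSpace ℝ (Fin 3), ‖m‖ = 1 ∧
        (∀ w ∈ fccSlots, ⟪F v.2 w, m⟫_ℝ = 0 ∨ ⟪F v.2 w, m⟫_ℝ = Real.sqrt (2 / 3) ∨ ⟪F v.2 w, m⟫_ℝ = -Real.sqrt (2 / 3)) ∧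
        (∀ w ∈ fccSlots, ⟪F v.2 w, m⟫_ℝ ≤ 0 → v.1 + F v.2 w ∈ X) ∧
        (∀ w ∈ fccSlots, ⟪F v.2 w, m⟫_ℝ < 0 → v.1 + (F v.2 w - (2 * ⟪F v.2 w, m⟫_ℝ) • m) ∈ X) ∧
        (∀ w ∈ fccSlots, 0 < ⟪F v.2 w, m⟫_ℝ → v.1 + F v.2 w ∉ X) ∧
        (⟪d v.2, m⟫_ℝ = Real.sqrt (2 / 3) ∨ ⟪d v.2, m⟫_ℝ = 0) with hmov
  set V := W.filter fun v => zlo ≤ v.1 2 ∧ v.1 2 < zcut ∧ v.1 ∉ P' with hV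
  set SRC := P'.filter fun p => (∀ w ∈ fccSlots, p + F root w ∈ X) ∧
      -R₀ - 1 < (p + d root) 2 ∧ (p + d root) 2 < h + R₀ + 1 with hSRC
  set S := SRC.image fun p => (p, root) with hS
  have htarget : ∀ v ∈ W, mov v → f v ∈ W ∧ (f v).1 - d (f v).2 = v.1 ∧ dist v.1 (f v).1 = 1 :=
    fun v hv hm => word_move_target hd hdn hmirror hdnext hW hf_full hf_cross hf_glide hv hm
  have hinjW : Set.InjOn f {v | v ∈ W ∧ mov v} :=
    word_move_injOn hX hd hmirror hinv hdnext (fun v hv => ((hW v).1 hv).2.2) hf_full hf_cross hf_glide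
  obtain ⟨u₀, hu₀, hdu₀⟩ := hd root
  have hP'X : P' ⊆ X := by
    intro p hp
    obtain ⟨hΛ, h1', h2', h3'⟩ := (hP' p).1 hp
    refine hP₁X ((hP₁ p).2 ⟨hΛ, by linarith, by linarith, ?_⟩)
    have hρ0 : (0 : ℝ) ≤ ρ - 1 := by linarith
    nlinarith
  have hSW : ∀ p ∈ SRC, (p, root) ∈ W := by
    intro p hp
    obtain ⟨hpP', hfull, -, -⟩ := mem_filter.1 hp
    obtain ⟨m, hm, hmenu, -⟩ := hdn root
    obtain ⟨u₁, hu₁, u₂, hu₂, u₃, hu₃, -, -, -, i12, i13, i23, -, -⟩ := exists_far_frame (F root) hm hmenu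
    refine (hW _).2 ⟨hP'X hpP', ⟨u₁, hu₁, u₂, hu₂, u₃, hu₃, i12, i13, i23, hfull u₁ hu₁, hfull u₂ hu₂, hfull u₃ hu₃⟩, ?_⟩
    show p - d root ∈ X
    rw [hdu₀, sub_eq_add_neg, ← map_neg]; exact hfull (-u₀) (neg_mem_fccSlots hu₀)
  have hSmov : ∀ p ∈ SRC, mov (p, root) := fun p hp => Or.inl (mem_filter.1 hp).2.1
  have hP'top : ∀ p ∈ P', p 2 ≤ zlo := fun p hp => by rw [hzlo]; exact ((hP' p).1 hp).2.2.1
  have hPmov : ∀ v ∈ W, mov v → P v → P (f v) := by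
    intro v hv hm hP
    rcases hm with hfull | ⟨m, hm1, hmenu, hown, hmir, hfar, hdm⟩
    · rw [hf_full v hv hfull]; exact hPfull v hv hP
    · rcases hdm with hdm | hdm
      · rw [hf_cross v hv m hm1 hmenu hown hmir hfar hdm]; exact hPcross v hv m hm1 hmenu hdm hP
      · rw [hf_glide v hv m hm1 hmenu hown hmir hfar hdm]; exact hPfull v hv hP
  -- (1) the orbit-restricted count
  obtain ⟨Q, hQ⟩ : ∃ Q : EuclideanSpace ℝ (Fin 3) × K → Prop, ∀ v, Q v ↔ (P v ∧ ∃ u ∈ W, mov u ∧ f u = v) :=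
    ⟨_, fun v => Iff.rfl⟩
  have hcount := card_sources_le_ends_add_exits_of_invariant V S f mov Q ?inj ?disj ?src ?ps ?pst
  rotate_left
  · -- injectivity on the moving states of `V ∪ S`
    intro x hx y hy hxy
    have hxW : x ∈ W ∧ mov x := by
      rcases hx.1 with h | h
      · exact ⟨(mem_filter.1 h).1, hx.2⟩
      · obtain ⟨p, hp, rfl⟩ := mem_image.1 h; exact ⟨hSW p hp, hx.2⟩
    have hyW : y ∈ W ∧ mov y := by
      rcases hy.1 with h | h
      · exact ⟨(mem_filter.1 h).1, hy.2⟩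
      · obtain ⟨p, hp, rfl⟩ := mem_image.1 h; exact ⟨hSW p hp, hy.2⟩
    exact hinjW hxW hyW hxy
  · -- sources are not windowed states
    rw [Finset.disjoint_left]
    intro s hs hsV
    obtain ⟨p, hp, rfl⟩ := mem_image.1 hs
    exact (mem_filter.1 hsV).2.2.2 (mem_filter.1 hp).1
  · -- sources move into `V`
    intro s hs
    obtain ⟨p, hp, rfl⟩ := mem_image.1 hs
    refine ⟨hSmov p hp, ?_⟩
    obtain ⟨-, hfull, hlo, hhi⟩ := mem_filter.1 hp
    have hfv : f (p, root) = (p + d root, root) := hf_full _ (hSW p hp) hfull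
    obtain ⟨hW', -, -⟩ := htarget _ (hSW p hp) (hSmov p hp)
    rw [hfv] at hW' ⊢
    rw [hV, mem_filter]
    refine ⟨hW', by rw [hzlo]; linarith, by rw [hzcut]; linarith, fun hP => ?_⟩
    have := hP'top _ hP
    simp only at this
    linarith
  · -- the invariant at the first image of a source
    intro s hs
    obtain ⟨p, hp, rfl⟩ := mem_image.1 hs
    obtain ⟨hpP', hfull, -, -⟩ := mem_filter.1 hp
    refine (hQ _).2 ⟨?_, (p, root), hSW p hp, hSmov p hp, rfl⟩
    rw [hf_full _ (hSW p hp) hfull]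
    exact hPsrc p hpP' hfull
  · -- the invariant is preserved inside the window
    intro v hv hm _ hP
    exact (hQ _).2 ⟨hPmov v (mem_filter.1 hv).1 hm ((hQ v).1 hP).1, v, (mem_filter.1 hv).1, hm, rfl⟩
  -- (2) the number of sources
  have hScard : S.card = SRC.card := by
    rw [hS, card_image_of_injective]
    intro p q hpq; exact (Prod.mk.inj hpq).1
  obtain ⟨E₁, E₂, hcount', hE₁, hE₂⟩ : ∃ E₁ E₂ : Finset (EuclideanSpace ℝ (Fin 3) × K),
      S.card ≤ E₁.card + E₂.card ∧
      (∀ v, v ∈ E₁ ↔ v ∈ V ∧ (¬ mov v ∧ Q v)) ∧ (∀ v, v ∈ E₂ ↔ v ∈ V ∧ (mov v ∧ f v ∉ V ∧ Q v)) :=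
    ⟨_, _, hcount, fun v => mem_filter, fun v => mem_filter⟩
  -- (3) the reachable ends, uncharged
  have hends : E₁.card ≤
      (W.filter fun v => zlo ≤ v.1 2 ∧ v.1 2 < zcut ∧ ¬ mov v ∧ P v ∧ ∃ u ∈ W, mov u ∧ f u = v).card := by
    refine card_le_card fun v hv => ?_
    obtain ⟨hvV, hnm, hQv⟩ := (hE₁ v).1 hv
    obtain ⟨hPv, hu⟩ := (hQ v).1 hQv
    obtain ⟨hvW, h1, h2, -⟩ := mem_filter.1 hvV
    exact mem_filter.2 ⟨hvW, h1, h2, hnm, hPv, hu⟩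
  -- (4) exits (reachable: they carry the invariant)
  set EX := V.filter fun v => mov v ∧ f v ∉ V ∧ Q v with hEX
  set RIMT := X.filter fun s => zcut ≤ s 2 ∧ s 2 ≤ zcut + 1 ∧ (ρ - 2) ^ 2 < s 0 ^ 2 + s 1 ^ 2 with hRIMT
  set RIMB := X.filter fun s => zlo - 1 ≤ s 2 ∧ s 2 < zlo ∧ (ρ - 1) ^ 2 < s 0 ^ 2 + s 1 ^ 2 with hRIMB
  have hexit : ∀ v ∈ EX, v ∈ W ∧ mov v ∧ zlo ≤ v.1 2 ∧ v.1 2 < zcut ∧ f v ∈ W ∧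
      (f v).1 - d (f v).2 = v.1 ∧ dist v.1 (f v).1 = 1 ∧
      ((f v).1 2 < zlo ∨ zcut ≤ (f v).1 2 ∨ (f v).1 ∈ P') := by
    intro v hv
    obtain ⟨hvV, hm, hnot, -⟩ := mem_filter.1 hv
    obtain ⟨hvW, h1, h2, -⟩ := mem_filter.1 hvV
    obtain ⟨hW', hback, hdist⟩ := htarget v hvW hm
    refine ⟨hvW, hm, h1, h2, hW', hback, hdist, ?_⟩
    by_contra hno
    push Not at hno
    exact hnot (by rw [hV, mem_filter]; exact ⟨hW', hno.1, hno.2.1, hno.2.2⟩)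
  have hvert : ∀ v ∈ EX, |(f v).1 2 - v.1 2| ≤ 1 := by
    intro v hv
    obtain ⟨-, -, -, -, -, -, hdist, -⟩ := hexit v hv
    have h1 := sq_sub_apply_le_dist_sq (f v).1 v.1 2
    rw [dist_comm, hdist, one_pow] at h1
    rw [← sq_le_one_iff_abs_le_one]; exact h1
  have hrigid : ∀ (G : EuclideanSpace ℝ (Fin 3) ≃ₗᵢ[ℝ] EuclideanSpace ℝ (Fin 3)) (v' : EuclideanSpace ℝ (Fin 3) × K),
      v' ∈ W → (∀ w ∈ fccSlots, v'.1 + G w ∈ X) →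
      ∃ a ∈ fccSlots, ∃ a' ∈ fccSlots, ∃ a'' ∈ fccSlots,
        ⟪a, a'⟫_ℝ = 1 / 2 ∧ ⟪a, a''⟫_ℝ = 1 / 2 ∧ ⟪a', a''⟫_ℝ = 1 / 2 ∧
        (∃ w ∈ fccSlots, G w = F v'.2 a) ∧ (∃ w ∈ fccSlots, G w = F v'.2 a') ∧
        (∃ w ∈ fccSlots, G w = F v'.2 a'') := by
    intro G v' hv' hGfull
    obtain ⟨-, ⟨a, ha, a', ha', a'', ha'', i1, i2, i3, h1, h2, h3⟩, -⟩ := (hW v').1 hv'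
    refine ⟨a, ha, a', ha', a'', ha'', i1, i2, i3, ?_, ?_, ?_⟩
    · exact shell_slot_of_full hX G hGfull h1 (by rw [LinearIsometryEquiv.norm_map, norm_eq_one_of_mem_fccSlots ha])
    · exact shell_slot_of_full hX G hGfull h2 (by rw [LinearIsometryEquiv.norm_map, norm_eq_one_of_mem_fccSlots ha'])
    · exact shell_slot_of_full hX G hGfull h3 (by rw [LinearIsometryEquiv.norm_map, norm_eq_one_of_mem_fccSlots ha''])
  have hnoP' : ∀ v ∈ EX, (f v).1 ∉ P' := by
    intro v hv hP
    obtain ⟨-, -, h1, -, hW', hback, -, -⟩ := hexit v hv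
    have hκ : (f v).2 = root := hroot _ (hrigid (F root) (f v) hW' (hP'full _ hP))
    have htop := hP'top _ hP
    have : v.1 2 = (f v).1 2 - d root 2 := by rw [← hback, hκ, PiLp.sub_apply]
    linarith
  have hbot : ∀ v ∈ EX, (f v).1 2 < zlo → (f v).1 ∈ RIMB := by
    intro v hv hlt
    obtain ⟨-, -, h1, -, hW', -, -, -⟩ := hexit v hv
    have hab := abs_le.1 (hvert v hv)
    have hsX : (f v).1 ∈ X := ((hW _).1 hW').1
    rw [hRIMB, mem_filter]
    refine ⟨hsX, by linarith [hab.1], hlt, ?_⟩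
    by_contra hlat
    push Not at hlat
    apply hnoP' v hv
    have hsP₁ : (f v).1 ∈ P₁ := by
      by_contra hns
      exact sealing_below (F root) t₁ (-(2 * R₀)) (-R₀) ρ hρ1 X P₁ hX hP₁X hP₁ _ hsX hns
        (by rw [hzlo] at hlt h1; linarith [hab.1]) (by rw [hzlo] at hlt; linarith) hlat
    rw [hP']
    refine ⟨((hP₁ _).1 hsP₁).1, ?_, by rw [hzlo] at hlt; linarith, hlat⟩
    rw [hzlo] at h1; linarith [hab.1]
  have htopc : ∀ v ∈ EX, zcut ≤ (f v).1 2 → (f v).1 ∈ RIMT := by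
    intro v hv hge
    by_contra hnr
    have hPv : P v := ((hQ v).1 (mem_filter.1 hv).2.2.2).1
    obtain ⟨hvW0, hm0, -, h2, hW', hback, -, -⟩ := hexit v hv
    have hab := abs_le.1 (hvert v hv)
    have hsX : (f v).1 ∈ X := ((hW _).1 hW').1
    have hs2 : (f v).1 2 ≤ zcut + 1 := by linarith [hab.2]
    have hlat : (f v).1 0 ^ 2 + (f v).1 1 ^ 2 ≤ (ρ - 2) ^ 2 := by
      by_contra hlt; push Not at hlt
      exact hnr (by rw [hRIMT, mem_filter]; exact ⟨hsX, hge, hs2, hlt⟩)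
    have hsP₂ : (f v).1 ∈ P₂ := by
      by_contra hns
      refine sealing_above G₂ t₂ (h + R₀) (h + 2 * R₀) ρ hρ1 X P₂ hX hP₂X hP₂ _ hsX hns
        (by rw [hzcut] at hge; linarith) (hcell _ hsX).2.1 ?_
      nlinarith [hlat]
    have hsΛ := ((hP₂ _).1 hsP₂).1
    have hnb : ∀ w ∈ fccSlots, (f v).1 + G₂ w ∈ X := by
      intro w hw
      apply hP₂X
      rw [hP₂]
      have hw2 : |(G₂ w) 2| ≤ 1 := by rw [apply_two_eq_inner_e₃]; exact abs_inner_slot_le_one G₂ hw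
      obtain ⟨hw2a, hw2b⟩ := abs_le.1 hw2
      refine ⟨movedFcc_add_site_mem G₂ t₂ hsΛ (mem_fcc_of_mem_fccSlots hw), ?_, ?_, ?_⟩
      · rw [PiLp.add_apply]; rw [hzcut] at hge; linarith
      · rw [PiLp.add_apply]; rw [hzcut] at hs2; linarith
      · have hρ2 : (0 : ℝ) ≤ ρ - 2 := by linarith
        have hsl : Real.sqrt ((f v).1 0 ^ 2 + (f v).1 1 ^ 2) ≤ ρ - 2 := by
          rw [← Real.sqrt_sq hρ2]; exact Real.sqrt_le_sqrt hlat
        have e1 := sqrt_lateral_add_le (f v).1 (G₂ w)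
        rw [LinearIsometryEquiv.norm_map, norm_eq_one_of_mem_fccSlots hw] at e1
        have e3 : Real.sqrt (((f v).1 + G₂ w) 0 ^ 2 + ((f v).1 + G₂ w) 1 ^ 2) ≤ ρ := by linarith
        have e4 := Real.sq_sqrt (by positivity : (0 : ℝ) ≤ ((f v).1 + G₂ w) 0 ^ 2 + ((f v).1 + G₂ w) 1 ^ 2)
        have e5 : (0 : ℝ) ≤ Real.sqrt (((f v).1 + G₂ w) 0 ^ 2 + ((f v).1 + G₂ w) 1 ^ 2) := Real.sqrt_nonneg _
        nlinarith
    exact hPexcl (f v) hW' (hPmov v hvW0 hm0 hPv) hsP₂ hnb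
  -- (5) counting the exits
  have hEXinj : Set.InjOn f ↑EX := by
    intro x hx y hy hxy
    have hx' := mem_filter.1 (Finset.mem_coe.1 hx)
    have hy' := mem_filter.1 (Finset.mem_coe.1 hy)
    exact hinjW ⟨(mem_filter.1 hx'.1).1, hx'.2.1⟩ ⟨(mem_filter.1 hy'.1).1, hy'.2.1⟩ hxy
  have hfibre : ∀ T : Finset (EuclideanSpace ℝ (Fin 3)), T ⊆ X →
      (W.filter fun v => v.1 ∈ T).card ≤ M * T.card := by
    intro T hT
    have hcov : (W.filter fun v => v.1 ∈ T) ⊆ T.biUnion fun s => W.filter fun v => v.1 = s := by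
      intro v hv
      rw [mem_biUnion]
      exact ⟨v.1, (mem_filter.1 hv).2, mem_filter.2 ⟨(mem_filter.1 hv).1, rfl⟩⟩
    refine (card_le_card hcov).trans (card_biUnion_le.trans ?_)
    calc ∑ s ∈ T, (W.filter fun v => v.1 = s).card ≤ ∑ s ∈ T, M := sum_le_sum fun s hs => hmult s (hT hs)
      _ = M * T.card := by rw [sum_const, smul_eq_mul, mul_comm]
  have hexits : EX.card ≤ M * RIMT.card + M * RIMB.card := by
    set EXR := EX.filter fun v => (f v).1 ∈ RIMT with hEXR
    set EXB := EX.filter fun v => (f v).1 ∈ RIMB with hEXB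
    have hsplit : EX ⊆ EXR ∪ EXB := by
      intro v hv
      obtain ⟨-, -, -, -, -, -, -, hcase⟩ := hexit v hv
      rw [mem_union]
      rcases hcase with hlt | hge | hP
      · exact Or.inr (mem_filter.2 ⟨hv, hbot v hv hlt⟩)
      · exact Or.inl (mem_filter.2 ⟨hv, htopc v hv hge⟩)
      · exact absurd hP (hnoP' v hv)
    have h2 : EXR.card ≤ M * RIMT.card := by
      refine le_trans ?_ (hfibre RIMT (filter_subset _ _))
      refine card_le_card_of_injOn f (fun v hv => ?_) fun x hx y hy hxy =>
        hEXinj (Finset.mem_coe.2 (mem_filter.1 (Finset.mem_coe.1 hx)).1)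
          (Finset.mem_coe.2 (mem_filter.1 (Finset.mem_coe.1 hy)).1) hxy
      obtain ⟨hvE, hr'⟩ := mem_filter.1 hv
      obtain ⟨-, -, -, -, hW', -, -, -⟩ := hexit v hvE
      exact mem_filter.2 ⟨hW', hr'⟩
    have h3 : EXB.card ≤ M * RIMB.card := by
      refine le_trans ?_ (hfibre RIMB (filter_subset _ _))
      refine card_le_card_of_injOn f (fun v hv => ?_) fun x hx y hy hxy =>
        hEXinj (Finset.mem_coe.2 (mem_filter.1 (Finset.mem_coe.1 hx)).1)
          (Finset.mem_coe.2 (mem_filter.1 (Finset.mem_coe.1 hy)).1) hxy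
      obtain ⟨hvE, hr'⟩ := mem_filter.1 hv
      obtain ⟨-, -, -, -, hW', -, -, -⟩ := hexit v hvE
      exact mem_filter.2 ⟨hW', hr'⟩
    calc EX.card ≤ (EXR ∪ EXB).card := card_le_card hsplit
      _ ≤ EXR.card + EXB.card := card_union_le _ _
      _ ≤ M * RIMT.card + M * RIMB.card := by linarith
  -- (6) assemble
  rw [← hScard]
  have hE₂EX : E₂.card ≤ EX.card := by
    refine card_le_card fun v hv => ?_
    obtain ⟨hvV, hm, hfv, hQv⟩ := (hE₂ v).1 hv
    rw [hEX, mem_filter]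
    exact ⟨hvV, hm, hfv, hQv⟩
  calc S.card ≤ E₁.card + E₂.card := hcount'
    _ ≤ _ := by
      rw [hzlo, hzcut] at hends
      rw [hRIMT, hRIMB, hzlo, hzcut] at hexits
      linarith [hends, hexits, hE₂EX]

end Core

end Summit.Ventures.Crystal3D.Theorems

end
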